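import Literature.Algebra.EuclideanLattices.LLLAlgorithmInvariant
import Mathlib.Analysis.InnerProductSpace.GramMatrix
import Mathlib.LinearAlgebra.Matrix.Block
import HarnessLib

/-!
# Termination of the LLL algorithm: discharge of `lll_halts_within`

Trunk: Lattice; sibling proof file of `LLLAlgorithm.lean`, continuing
`LLLAlgorithmInvariant.lean`. We prove the first half of the proof of Prop. 1.26 of
A. K. Lenstra, H. W. Lenstra Jr., L. Lovász, *Factoring polynomials with rational coefficients*,
Math. Ann. 261 (1982) (LLL82), in the numbered form of M. R. Bremner, *Lattice Basis Reduction*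
(CRC 2011), §4.3 (Def. 4.15, Lemmas 4.14–4.18, Thm. 4.19):

* `Literature.Lattice.gramDet f i`, `Literature.Lattice.lllPotential f` — the Gram determinants
  `dᵢ = det (⟪bⱼ, bₗ⟫)_{j,l<i}` of the prefixes and the potential `D = ∏_{i<n} dᵢ`
  (LLL82 (1.24)–(1.25); Bremner Def. 4.15);
* `det_gram_eq_prod_sq_norm_gramSchmidt` — `det (⟪bᵢ, bⱼ⟫) = ∏ ‖b*ᵢ‖²` for every finite
  family (the Gram matrix is `N Lᵀ` with `N = (⟪bᵢ, b*ₗ⟫)` lower triangular and `L` unit lower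
  triangular); hence `dᵢ = ∏_{j<i} ‖b*ⱼ‖²` (`gramDet_eq_prod`), `dᵢ ≤ Bⁱ` and
  `D ≤ B^{n(n-1)/2}` under `‖bⱼ‖² ≤ B` (Hadamard; Bremner Lemma 4.16), and `dᵢ ∈ ℤ`, `dᵢ ≥ 1`,
  `D ≥ 1` for linearly independent integer vectors (`one_le_lllPotential`);
* `gramSchmidt_swap_adjacent` — the exchange lemma `c*ₖ₋₁ = b*ₖ + μₖ,ₖ₋₁ b*ₖ₋₁`
  (Bremner Lemma 4.12), whence `D(exchange) ≤ δ · D` when the Lovász test fails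
  (`lllPotential_swap_le`, Bremner Lemma 4.17), while size reductions fix every `dᵢ`
  (Bremner Lemma 4.14) and both fix `dₙ` (so linear independence is kept along the run);
* `lllStep_dichotomy` — a pass either raises the index by one fixing `D`, or lowers it by at
  most one multiplying `D` by a factor `≤ δ`;
* `Literature.Lattice.lll_halts_within_holds : lll_halts_within` — with
  `Nₜ = ⌊log Dₜ / log(1/δ)⌋₊` the quantity `t + 2Nₜ + 1 ≤ kₜ + 2N₀` is invariant while the
  algorithm runs (an exchange forces `Nₜ₊₁ + 1 ≤ Nₜ` because `Dₜ₊₁ ≥ 1`), and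
  `N₀ ≤ ⌊(n(n-1)/2) log B / log(1/δ)⌋₊`; this is Bremner Thm. 4.19 / LLL82's count
  "`k` is decreased at most `log_{4/3} B^{n(n-1)/2}` times".

## References

* A. K. Lenstra, H. W. Lenstra Jr., L. Lovász, Math. Ann. 261 (1982), §1, (1.24)–(1.25) and
  the proof of Prop. 1.26.
* M. R. Bremner, *Lattice Basis Reduction*, CRC Press 2011, §4.3.
* H. Cohen, *A Course in Computational Algebraic Number Theory*, GTM 138, 1993, proof of
  Algorithm 2.6.3, pp. 134–135.
-/

noncomputable section
namespace Literature.Algebra.EuclideanLattices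

open InnerProductSpace Function Submodule Finset
open scoped RealInnerProductSpace Matrix

section GramDet

variable {E : Type*} [NormedAddCommGroup E] [InnerProductSpace ℝ E]
variable {ι : Type*} [LinearOrder ι] [LocallyFiniteOrderBot ι] [WellFoundedLT ι]

/-- The Gram–Schmidt decomposition written as a sum over all indices with the unit lower
triangular coefficient matrix `L_{jl} = μⱼₗ (l < j), 1 (l = j), 0 (l > j)`. [folklore] -/
theorem sum_gsL_smul_gramSchmidt [Fintype ι] (f : ι → E) (j : ι) :
    ∑ l, (if l < j then gsCoeff f j l else if l = j then 1 else 0) • gramSchmidt ℝ f l = f j := by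
  have hsplit : ∀ l, (if l < j then gsCoeff f j l else if l = j then 1 else 0) • gramSchmidt ℝ f l
      = (if l ∈ Finset.Iio j then gsCoeff f j l • gramSchmidt ℝ f l else 0) +
        (if l = j then gramSchmidt ℝ f l else 0) := by
    intro l
    by_cases h : l < j
    · simp [h, h.ne]
    · by_cases h' : l = j
      · subst h'; simp
      · simp [h, h']
  simp_rw [hsplit]
  rw [Finset.sum_add_distrib, Finset.sum_ite_mem, Finset.univ_inter, Finset.sum_ite_eq' _ j,
    if_pos (Finset.mem_univ _)]
  conv_rhs => rw [self_eq_gramSchmidt_add_sum f j]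
  abel

/-- **Gram determinant = product of the squared Gram–Schmidt norms** (`dᵢ = ∏ ‖b*ⱼ‖²`,
LLL82 (1.24)–(1.25); Bremner (4.4)–(4.5)): the Gram matrix factors as `N Lᵀ` with
`N_{il} = ⟪bᵢ, b*ₗ⟫` lower triangular with diagonal `‖b*ᵢ‖²` and `L` unit lower triangular.
No independence hypothesis is needed.
[cite: LenstraLenstraLovasz1982, (1.24)] [cite: Bremner2011, (4.5)] -/
theorem det_gram_eq_prod_sq_norm_gramSchmidt [Fintype ι] (f : ι → E) :
    (Matrix.gram ℝ f).det = ∏ i, ‖gramSchmidt ℝ f i‖ ^ 2 := by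
  set N : Matrix ι ι ℝ := Matrix.of fun i l => ⟪f i, gramSchmidt ℝ f l⟫ with hN
  set L : Matrix ι ι ℝ :=
    Matrix.of fun j l => if l < j then gsCoeff f j l else if l = j then 1 else 0 with hL
  have hgram : Matrix.gram ℝ f = N * Lᵀ := by
    ext i j
    rw [Matrix.gram_apply, Matrix.mul_apply]
    conv_lhs => rw [← sum_gsL_smul_gramSchmidt f j, inner_sum]
    refine Finset.sum_congr rfl fun l _ => ?_
    rw [real_inner_smul_right, Matrix.transpose_apply, hN, hL, Matrix.of_apply, Matrix.of_apply,
      mul_comm]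
  have hNt : N.BlockTriangular OrderDual.toDual := by
    intro i l hil
    have hil' : i < l := hil
    rw [hN, Matrix.of_apply, real_inner_comm]
    exact gramSchmidt_inv_triangular ℝ f hil'
  have hLt : L.BlockTriangular OrderDual.toDual := by
    intro i l hil
    have hil' : i < l := hil
    rw [hL, Matrix.of_apply, if_neg (not_lt.2 hil'.le), if_neg hil'.ne']
  rw [hgram, Matrix.det_mul, Matrix.det_transpose, Matrix.det_of_lowerTriangular N hNt,
    Matrix.det_of_lowerTriangular L hLt]
  have h1 : ∏ i, L i i = 1 := Finset.prod_eq_one fun i _ => by simp [hL]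
  rw [h1, mul_one]
  exact Finset.prod_congr rfl fun i _ => by rw [hN, Matrix.of_apply, inner_self_gramSchmidt]

end GramDet

section Reindex

variable {E : Type*} [NormedAddCommGroup E] [InnerProductSpace ℝ E]

/-- The Gram determinant is invariant under reindexing the family. [folklore] -/
theorem det_gram_comp_equiv {ι κ : Type*} [Fintype ι] [DecidableEq ι] [Fintype κ] [DecidableEq κ]
    (f : ι → E) (e : κ ≃ ι) : (Matrix.gram ℝ (f ∘ e)).det = (Matrix.gram ℝ f).det := by
  rw [show Matrix.gram ℝ (f ∘ ⇑e) = (Matrix.gram ℝ f).submatrix e e from rfl,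
    Matrix.det_submatrix_equiv_self]

end Reindex

section Prefix

variable {E : Type*} [NormedAddCommGroup E] [InnerProductSpace ℝ E] {n : ℕ}

/-- The initial segment below `castLE j` is the image of the initial segment below `j`. [folklore] -/
theorem image_castLE_Iio {i : ℕ} (hi : i ≤ n) (j : Fin i) :
    Fin.castLE hi '' Set.Iio j = Set.Iio (Fin.castLE hi j) := by
  ext l
  simp only [Set.mem_image, Set.mem_Iio]
  constructor
  · rintro ⟨l', hl', rfl⟩
    exact hl'
  · intro hl
    have hl' : (l : ℕ) < i := lt_of_lt_of_le (Fin.lt_def.1 hl) (le_of_lt j.isLt)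
    exact ⟨⟨l, hl'⟩, Fin.lt_def.2 (Fin.lt_def.1 hl), Fin.ext rfl⟩

/-- **Gram–Schmidt vectors of a prefix family** are those of the whole family.
[folklore] -/
theorem gramSchmidt_comp_castLE (f : Fin n → E) {i : ℕ} (hi : i ≤ n) (j : Fin i) :
    gramSchmidt ℝ (f ∘ Fin.castLE hi) j = gramSchmidt ℝ f (Fin.castLE hi j) := by
  have hs : (f ∘ Fin.castLE hi) '' Set.Iio j = f '' Set.Iio (Fin.castLE hi j) := by
    rw [Set.image_comp, image_castLE_Iio]
  symm
  apply eq_gramSchmidt_of_sub_mem_span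
  · rw [hs]; exact gramSchmidt_sub_self_mem_span f _
  · intro u hu
    rw [hs] at hu
    exact inner_gramSchmidt_eq_zero_of_mem_span f hu

/-- The Gram determinant of the first `i` vectors is the product of the first `i` squared
Gram–Schmidt norms (`dᵢ = ∏_{j<i} ‖b*ⱼ‖²`, LLL82 (1.24); Bremner (4.5)).
[cite: LenstraLenstraLovasz1982, (1.24)] [cite: Bremner2011, (4.5)] -/
theorem det_gram_comp_castLE (f : Fin n → E) {i : ℕ} (hi : i ≤ n) :
    (Matrix.gram ℝ (f ∘ Fin.castLE hi)).det = ∏ j : Fin i, ‖gramSchmidt ℝ f (Fin.castLE hi j)‖ ^ 2 := by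
  rw [det_gram_eq_prod_sq_norm_gramSchmidt]
  exact Finset.prod_congr rfl fun j _ => by rw [gramSchmidt_comp_castLE]

end Prefix


section Potential

variable {E : Type*} [NormedAddCommGroup E] [InnerProductSpace ℝ E] {n : ℕ}

/-- The Gram determinant `dᵢ` of the first `i` vectors of a family `b₀, …, bₙ₋₁`
(`d₀ = 1`). [cite: LenstraLenstraLovasz1982, (1.24)] [cite: Bremner2011, Def. 4.15] -/
def gramDet (f : Fin n → E) (i : ℕ) (hi : i ≤ n) : ℝ :=
  (Matrix.gram ℝ (f ∘ Fin.castLE hi)).det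

/-- The potential `D = ∏_{i<n} dᵢ` of the termination argument of LLL82 Prop. 1.26
(`d₀ = 1` contributes nothing; `dₙ` is omitted). [cite: LenstraLenstraLovasz1982, (1.25)] [cite: Bremner2011, Def. 4.15] -/
def lllPotential (f : Fin n → E) : ℝ :=
  ∏ i : Fin n, gramDet f i (le_of_lt i.isLt)

/-- `dᵢ = ∏_{j<i} ‖b*ⱼ‖²`. [cite: LenstraLenstraLovasz1982, (1.24)] [cite: Bremner2011, (4.5)] -/
theorem gramDet_eq_prod (f : Fin n → E) (i : ℕ) (hi : i ≤ n) :
    gramDet f i hi = ∏ j : Fin i, ‖gramSchmidt ℝ f (Fin.castLE hi j)‖ ^ 2 :=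
  det_gram_comp_castLE f hi

/-- `dᵢ ≥ 0`. [folklore] -/
theorem gramDet_nonneg (f : Fin n → E) (i : ℕ) (hi : i ≤ n) : 0 ≤ gramDet f i hi := by
  rw [gramDet_eq_prod]
  exact Finset.prod_nonneg fun j _ => sq_nonneg _

/-- `dᵢ > 0` for a linearly independent family. [cite: Bremner2011, Lemma 4.16 (proof)] -/
theorem gramDet_pos {f : Fin n → E} (hf : LinearIndependent ℝ f) (i : ℕ) (hi : i ≤ n) :
    0 < gramDet f i hi := by
  rw [gramDet_eq_prod]
  exact Finset.prod_pos fun j _ => pow_pos (norm_pos_iff.2 (gramSchmidt_ne_zero _ hf)) 2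

/-- `D ≥ 0`. [folklore] -/
theorem lllPotential_nonneg (f : Fin n → E) : 0 ≤ lllPotential f :=
  Finset.prod_nonneg fun i _ => gramDet_nonneg f i _

/-- `D > 0` for a linearly independent family. [cite: Bremner2011, Lemma 4.16 (proof)] -/
theorem lllPotential_pos {f : Fin n → E} (hf : LinearIndependent ℝ f) : 0 < lllPotential f :=
  Finset.prod_pos fun i _ => gramDet_pos hf i _

/-- The Gram determinants depend only on the Gram–Schmidt vectors. [folklore] -/
theorem gramDet_congr_of_gramSchmidt_eq {f g : Fin n → E}
    (h : gramSchmidt ℝ f = gramSchmidt ℝ g) (i : ℕ) (hi : i ≤ n) :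
    gramDet f i hi = gramDet g i hi := by
  rw [gramDet_eq_prod, gramDet_eq_prod, h]

/-- The potential depends only on the Gram–Schmidt vectors. [folklore] -/
theorem lllPotential_congr_of_gramSchmidt_eq {f g : Fin n → E}
    (h : gramSchmidt ℝ f = gramSchmidt ℝ g) : lllPotential f = lllPotential g :=
  Finset.prod_congr rfl fun i _ => gramDet_congr_of_gramSchmidt_eq h i _

/-- `dᵢ ≤ Bⁱ` if all `‖bⱼ‖² ≤ B` (Hadamard: `‖b*ⱼ‖ ≤ ‖bⱼ‖`). [cite: LenstraLenstraLovasz1982, proof of Prop. 1.26] [cite: Bremner2011, Lemma 4.16] -/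
theorem gramDet_le_pow (f : Fin n → E) {B : ℝ} (hB : ∀ j, ‖f j‖ ^ 2 ≤ B) (i : ℕ) (hi : i ≤ n) :
    gramDet f i hi ≤ B ^ i := by
  rw [gramDet_eq_prod]
  calc ∏ j : Fin i, ‖gramSchmidt ℝ f (Fin.castLE hi j)‖ ^ 2 ≤ ∏ _j : Fin i, B :=
        Finset.prod_le_prod (fun j _ => sq_nonneg _) fun j _ =>
          (hB _).trans' (by
            rw [sq_norm_eq_sq_norm_gramSchmidt_add_sum f (Fin.castLE hi j)]
            exact le_add_of_nonneg_right (Finset.sum_nonneg fun l _ =>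
              mul_nonneg (sq_nonneg _) (sq_nonneg _)))
    _ = B ^ i := by simp

/-- `D ≤ B^{n(n-1)/2}` if all `‖bⱼ‖² ≤ B` and `0 ≤ B`... stated with the natural exponent
`∑_{i<n} i`. [cite: LenstraLenstraLovasz1982, proof of Prop. 1.26] [cite: Bremner2011, Lemma 4.16] -/
theorem lllPotential_le_pow (f : Fin n → E) {B : ℝ} (hB : ∀ j, ‖f j‖ ^ 2 ≤ B) :
    lllPotential f ≤ B ^ (∑ i ∈ Finset.range n, i) := by
  unfold lllPotential
  calc ∏ i : Fin n, gramDet f i (le_of_lt i.isLt) ≤ ∏ i : Fin n, B ^ (i : ℕ) :=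
        Finset.prod_le_prod (fun i _ => gramDet_nonneg f i _) fun i _ => gramDet_le_pow f hB i _
    _ = B ^ (∑ i ∈ Finset.range n, i) := by
        rw [Finset.prod_pow_eq_pow_sum, Fin.sum_univ_eq_sum_range (fun i => i) n]

end Potential

/-! ### Small facts on the Gram determinants -/

section GramDetFacts

variable {E : Type*} [NormedAddCommGroup E] [InnerProductSpace ℝ E] {n : ℕ}

/-- `d_{j+1} = dⱼ ‖b*ⱼ‖²`. [cite: LenstraLenstraLovasz1982, (1.24)] -/
theorem gramDet_succ (f : Fin n → E) (j : Fin n) :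
    gramDet f (j + 1) j.isLt = gramDet f j (le_of_lt j.isLt) * ‖gramSchmidt ℝ f j‖ ^ 2 := by
  rw [gramDet_eq_prod, gramDet_eq_prod, Fin.prod_univ_castSucc]
  rfl

/-- Gram determinants with equal lengths are equal (proof-irrelevance helper). [folklore] -/
theorem gramDet_eq_of_eq (f : Fin n → E) {i i' : ℕ} (h : i = i') (hi : i ≤ n) (hi' : i' ≤ n) :
    gramDet f i hi = gramDet f i' hi' := by
  subst h
  rfl

/-- Linear independence is equivalent to `dₙ ≠ 0` (Mathlib's
`Matrix.det_gram_ne_zero_iff_linearIndependent`). [folklore] -/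
theorem linearIndependent_iff_gramDet_ne_zero (f : Fin n → E) :
    LinearIndependent ℝ f ↔ gramDet f n le_rfl ≠ 0 := by
  unfold gramDet
  rw [show f ∘ Fin.castLE (le_refl n) = f from funext fun l => by simp,
    Matrix.det_gram_ne_zero_iff_linearIndependent]

/-- Families with the same Gram–Schmidt vectors are linearly independent together. [folklore] -/
theorem linearIndependent_of_gramSchmidt_eq {f g : Fin n → E}
    (h : gramSchmidt ℝ f = gramSchmidt ℝ g) (hf : LinearIndependent ℝ f) : LinearIndependent ℝ g := by
  rw [linearIndependent_iff_gramDet_ne_zero] at hf ⊢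
  rwa [← gramDet_congr_of_gramSchmidt_eq h]

/-- `d₀ = 1`. [folklore] -/
theorem gramDet_zero (f : Fin n → E) : gramDet f 0 (Nat.zero_le n) = 1 := by
  rw [gramDet_eq_prod]; rfl

end GramDetFacts

/-! ### The exchange step -/

section Exchange

variable {E : Type*} [NormedAddCommGroup E] [InnerProductSpace ℝ E] {n : ℕ}

/-- **Exchange lemma** (LLL82 §1, the formula for `c*ₖ₋₁`; Bremner Lemma 4.12): after
exchanging the adjacent vectors `bⱼ, bⱼ₊₁`, the new `j`-th Gram–Schmidt vector is
`b*ⱼ₊₁ + μⱼ₊₁,ⱼ b*ⱼ`. [cite: LenstraLenstraLovasz1982, §1 (proof of termination)] [cite: Bremner2011, Lemma 4.12] -/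
theorem gramSchmidt_swap_adjacent (f : Fin n → E) (j k : Fin n) (hjk : (k : ℕ) = j + 1) :
    gramSchmidt ℝ (f ∘ Equiv.swap j k) j =
      gramSchmidt ℝ f k + gsCoeff f k j • gramSchmidt ℝ f j := by
  have hjk' : j < k := Fin.lt_def.2 (by omega)
  have himg : (f ∘ Equiv.swap j k) '' Set.Iio j = f '' Set.Iio j := by
    refine Set.image_congr fun l hl => ?_
    rw [comp_apply, Equiv.swap_apply_of_ne_of_ne (ne_of_lt hl) (ne_of_lt (lt_trans hl hjk'))]
  have hIio : Finset.Iio k = insert j (Finset.Iio j) := by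
    ext l
    simp only [Finset.mem_Iio, Finset.mem_insert, Fin.lt_def, Fin.ext_iff]
    omega
  symm
  apply eq_gramSchmidt_of_sub_mem_span
  · rw [himg, comp_apply, Equiv.swap_apply_left]
    have hdec := self_eq_gramSchmidt_add_sum f k
    rw [hIio, Finset.sum_insert (by simp)] at hdec
    rw [show gramSchmidt ℝ f k + gsCoeff f k j • gramSchmidt ℝ f j - f k =
        -(∑ l ∈ Finset.Iio j, gsCoeff f k l • gramSchmidt ℝ f l) by
      conv_lhs => rw [hdec]
      abel]
    refine neg_mem (Submodule.sum_mem _ fun l hl => smul_mem _ _ ?_)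
    rw [← span_gramSchmidt_Iio ℝ f j]
    exact subset_span ⟨l, Finset.mem_Iio.1 hl, rfl⟩
  · intro u hu
    rw [himg] at hu
    have hu' : u ∈ span ℝ (f '' Set.Iio k) :=
      span_mono (Set.image_mono (Set.Iio_subset_Iio hjk'.le)) hu
    rw [inner_add_right, real_inner_smul_right, inner_gramSchmidt_eq_zero_of_mem_span f hu',
      inner_gramSchmidt_eq_zero_of_mem_span f hu, mul_zero, add_zero]

/-- Prefixes not separating the exchanged pair have the same Gram determinant. (i) Short
prefixes are untouched. [folklore] -/
theorem gramDet_swap_of_le (f : Fin n → E) (j k : Fin n) (hjk : j < k) (i : ℕ) (hi : i ≤ n)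
    (hij : i ≤ j) : gramDet (f ∘ Equiv.swap j k) i hi = gramDet f i hi := by
  unfold gramDet
  congr 2
  funext l
  rw [comp_apply, comp_apply, comp_apply, Equiv.swap_apply_of_ne_of_ne]
  · exact fun h => by have := congrArg Fin.val h; simp at this; omega
  · exact fun h => by have := congrArg Fin.val h; have := Fin.lt_def.1 hjk; simp at *; omega

/-- (ii) Long prefixes contain both exchanged vectors: the Gram determinant is invariant under
the permutation. [folklore] -/
theorem gramDet_swap_of_lt (f : Fin n → E) (j k : Fin n) (hjk : j < k) (i : ℕ) (hi : i ≤ n)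
    (hki : (k : ℕ) < i) : gramDet (f ∘ Equiv.swap j k) i hi = gramDet f i hi := by
  unfold gramDet
  have hj : (j : ℕ) < i := lt_trans (Fin.lt_def.1 hjk) hki
  set j' : Fin i := ⟨j, hj⟩
  set k' : Fin i := ⟨k, hki⟩
  have hcomm : (f ∘ Equiv.swap j k) ∘ Fin.castLE hi = (f ∘ Fin.castLE hi) ∘ Equiv.swap j' k' := by
    funext l
    simp only [comp_apply]
    congr 1
    by_cases h1 : l = j'
    · subst h1; rw [Equiv.swap_apply_left]; exact Equiv.swap_apply_left _ _
    · by_cases h2 : l = k'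
      · subst h2; rw [Equiv.swap_apply_right]; exact Equiv.swap_apply_right _ _
      · rw [Equiv.swap_apply_of_ne_of_ne h1 h2, Equiv.swap_apply_of_ne_of_ne]
        · exact fun h => h1 (Fin.ext (by have := congrArg Fin.val h; simpa using this))
        · exact fun h => h2 (Fin.ext (by have := congrArg Fin.val h; simpa using this))
  rw [hcomm, det_gram_comp_equiv]

/-- (iii) The prefix ending with the first exchanged position: its Gram determinant is
multiplied by `‖b*ⱼ₊₁ + μ b*ⱼ‖² / ‖b*ⱼ‖²`, hence by a factor `≤ δ` when the Lovász test
fails (LLL82: `d'ₖ₋₁ < ¾ dₖ₋₁`; Bremner Lemma 4.14/4.17).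
[cite: LenstraLenstraLovasz1982, §1 (proof of termination)] [cite: Bremner2011, Lemma 4.17] -/
theorem gramDet_swap_succ_le (δ : ℝ) (f : Fin n → E) (j k : Fin n) (hjk : (k : ℕ) = j + 1)
    (hlov : ¬ LovaszTestAt δ f j k) :
    gramDet (f ∘ Equiv.swap j k) k (le_of_lt k.isLt) ≤ δ * gramDet f k (le_of_lt k.isLt) := by
  obtain ⟨kv, hkv⟩ := k
  simp only at hjk
  subst hjk
  rw [gramDet_eq_prod, gramDet_eq_prod, Fin.prod_univ_castSucc, Fin.prod_univ_castSucc,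
    mul_left_comm]
  have hlast : Fin.castLE (le_of_lt hkv) (Fin.last j) = j := Fin.ext rfl
  have hpre : ∀ l : Fin j, Fin.castLE (le_of_lt hkv) l.castSucc < j :=
    fun l => Fin.lt_def.2 (by simp)
  have hprod : ∏ l : Fin j, ‖gramSchmidt ℝ (f ∘ Equiv.swap j ⟨(j : ℕ) + 1, hkv⟩)
      (Fin.castLE (le_of_lt hkv) l.castSucc)‖ ^ 2 =
      ∏ l : Fin j, ‖gramSchmidt ℝ f (Fin.castLE (le_of_lt hkv) l.castSucc)‖ ^ 2 := by
    refine Finset.prod_congr rfl fun l _ => ?_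
    rw [gramSchmidt_congr_of_forall_le (g := f)]
    intro l' hl'
    have h1 : l' < j := lt_of_le_of_lt hl' (hpre l)
    rw [comp_apply, Equiv.swap_apply_of_ne_of_ne (ne_of_lt h1)
      (ne_of_lt (lt_trans h1 (Fin.lt_def.2 (by simp))))]
  rw [hprod, hlast]
  refine mul_le_mul_of_nonneg_left ?_ (Finset.prod_nonneg fun l _ => by positivity)
  rw [gramSchmidt_swap_adjacent f j ⟨(j : ℕ) + 1, hkv⟩ rfl]
  unfold LovaszTestAt at hlov
  exact le_of_lt (not_le.1 hlov)

/-- **The potential loses a factor `δ` at each exchange** (LLL82, proof of Prop. 1.26;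
Bremner Lemma 4.17): if the Lovász test fails at `(j, j+1)` then
`D(b ∘ swap) ≤ δ · D(b)`. [cite: LenstraLenstraLovasz1982, Prop. 1.26 (proof)] [cite: Bremner2011, Lemma 4.17] -/
theorem lllPotential_swap_le (δ : ℝ) (f : Fin n → E) (j k : Fin n)
    (hjk : (k : ℕ) = j + 1) (hlov : ¬ LovaszTestAt δ f j k) :
    lllPotential (f ∘ Equiv.swap j k) ≤ δ * lllPotential f := by
  unfold lllPotential
  have hk : k ∈ (Finset.univ : Finset (Fin n)) := Finset.mem_univ _
  rw [← Finset.mul_prod_erase _ _ hk, ← Finset.mul_prod_erase _ _ hk, ← mul_assoc]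
  have hjk' : j < k := Fin.lt_def.2 (by omega)
  have hrest : ∏ i ∈ Finset.univ.erase k, gramDet (f ∘ Equiv.swap j k) i (le_of_lt i.isLt) =
      ∏ i ∈ Finset.univ.erase k, gramDet f i (le_of_lt i.isLt) := by
    refine Finset.prod_congr rfl fun i hi => ?_
    have hik : i ≠ k := Finset.ne_of_mem_erase hi
    rcases lt_or_gt_of_ne hik with h | h
    · exact gramDet_swap_of_le f j k hjk' i _ (by have := Fin.lt_def.1 h; omega)
    · exact gramDet_swap_of_lt f j k hjk' i _ (Fin.lt_def.1 h)
  rw [hrest]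
  refine mul_le_mul_of_nonneg_right ?_ (Finset.prod_nonneg fun i _ => gramDet_nonneg f i _)
  exact gramDet_swap_succ_le δ f j k hjk hlov

/-- The full Gram determinant `dₙ` is invariant under the exchange. [folklore] -/
theorem gramDet_self_swap (f : Fin n → E) (j k : Fin n) :
    gramDet (f ∘ Equiv.swap j k) n le_rfl = gramDet f n le_rfl := by
  unfold gramDet
  have : ∀ g : Fin n → E, g ∘ Fin.castLE (le_refl n) = g := fun g => funext fun l => by simp
  rw [this, this, det_gram_comp_equiv]

end Exchange

/-! ### The potential along the algorithm -/

section Dynamics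

variable {E : Type*} [NormedAddCommGroup E] [InnerProductSpace ℝ E]
variable {V : Type*} [AddCommGroup V] (φ : V →+ E) {n : ℕ}

/-- `reduce(k, l)`, `l < k`, does not change any `dᵢ`. [cite: Bremner2011, Lemma 4.14] -/
theorem gramDet_lllSizeReduce (b : Fin n → V) {k l : Fin n} (hlk : l < k) (i : ℕ) (hi : i ≤ n) :
    gramDet (⇑φ ∘ lllSizeReduce φ b k l) i hi = gramDet (⇑φ ∘ b) i hi :=
  gramDet_congr_of_gramSchmidt_eq (gramSchmidt_lllSizeReduce φ b hlk) i hi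

/-- The size-reduction loop does not change any `dᵢ`. [cite: Bremner2011, Lemma 4.14] -/
theorem gramDet_lllSizeReduceBelow (b : Fin n → V) (k : Fin n) (i : ℕ) (hi : i ≤ n) :
    gramDet (⇑φ ∘ lllSizeReduceBelow φ b k) i hi = gramDet (⇑φ ∘ b) i hi :=
  gramDet_congr_of_gramSchmidt_eq (lllSizeReduceFrom_spec φ k (k.val - 1) _ (by omega) b).1 i hi

/-- **One pass of the algorithm, seen by the potential** (LLL82, proof of Prop. 1.26; Bremner
Lemma 4.17 and Thm. 4.19, proof): from a running state (`0 < k < n`) either the index goes up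
by one and `D` is unchanged, or the index goes down by at most one and `D` is multiplied by a
factor `≤ δ`; in both cases the full Gram determinant `dₙ` is unchanged.
[cite: LenstraLenstraLovasz1982, Prop. 1.26 (proof)] [cite: Bremner2011, Thm. 4.19 (proof)] -/
theorem lllStep_dichotomy (δ : ℝ) (s : LLLState n V) (hk : 0 < s.k ∧ s.k < n) :
    gramDet (⇑φ ∘ (lllStep φ δ s).b) n le_rfl = gramDet (⇑φ ∘ s.b) n le_rfl ∧
    (((lllStep φ δ s).k = s.k + 1 ∧
        lllPotential (⇑φ ∘ (lllStep φ δ s).b) = lllPotential (⇑φ ∘ s.b)) ∨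
      ((lllStep φ δ s).k = max 1 (s.k - 1) ∧
        lllPotential (⇑φ ∘ (lllStep φ δ s).b) ≤ δ * lllPotential (⇑φ ∘ s.b))) := by
  unfold lllStep
  rw [dif_pos hk]
  dsimp only
  set k : Fin n := ⟨s.k, hk.2⟩ with hkdef
  set j₀ : Fin n := ⟨s.k - 1, by omega⟩ with hj₀def
  have hjk : j₀ < k := Fin.mk_lt_mk.2 (by omega)
  have hjk' : (k : ℕ) = j₀ + 1 := by simp [hkdef, hj₀def]; omega
  set b₁ := lllSizeReduce φ s.b k j₀ with hb₁def
  have hD₁ : lllPotential (⇑φ ∘ b₁) = lllPotential (⇑φ ∘ s.b) :=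
    lllPotential_congr_of_gramSchmidt_eq (gramSchmidt_lllSizeReduce φ s.b hjk)
  have hd₁ : gramDet (⇑φ ∘ b₁) n le_rfl = gramDet (⇑φ ∘ s.b) n le_rfl :=
    gramDet_lllSizeReduce φ s.b hjk n le_rfl
  split_ifs with ht
  · dsimp only
    refine ⟨(gramDet_lllSizeReduceBelow φ b₁ k n le_rfl).trans hd₁, Or.inl ⟨rfl, ?_⟩⟩
    rw [← hD₁]
    exact lllPotential_congr_of_gramSchmidt_eq
      (lllSizeReduceFrom_spec φ k (k.val - 1) _ (by omega) b₁).1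
  · dsimp only
    rw [show (⇑φ ∘ b₁ ∘ ⇑(Equiv.swap j₀ k)) = (⇑φ ∘ b₁) ∘ ⇑(Equiv.swap j₀ k) from rfl]
    refine ⟨(gramDet_self_swap _ j₀ k).trans hd₁, Or.inr ⟨rfl, ?_⟩⟩
    rw [← hD₁]
    exact lllPotential_swap_le δ _ j₀ k hjk' ht

end Dynamics


/-! ### Integrality of the Gram determinants of integer vectors -/

section Integer

variable {m : ℕ}

/-- The Gram matrix of integer vectors is the integer matrix of dot products, cast to `ℝ`.
[cite: LenstraLenstraLovasz1982, §1 (the dᵢ are positive integers)] -/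
theorem gram_intVecToEuclidean {ι : Type*} (b : ι → (Fin m → ℤ)) :
    Matrix.gram ℝ (fun i => intVecToEuclidean m (b i)) =
      (Matrix.of fun i j => ∑ t, b i t * b j t).map (Int.cast : ℤ → ℝ) := by
  ext i j
  simp only [Matrix.gram_apply, PiLp.inner_apply, intVecToEuclidean_apply, RCLike.inner_apply,
    conj_trivial, Matrix.map_apply, Matrix.of_apply, Int.cast_sum, Int.cast_mul]
  exact Finset.sum_congr rfl fun t _ => mul_comm _ _

/-- Hence every Gram determinant `dᵢ` of integer vectors is an integer.
[cite: LenstraLenstraLovasz1982, §1 (the dᵢ are positive integers)] [cite: Bremner2011, Lemma 4.16 (proof)] -/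
theorem exists_gramDet_eq_intCast {n : ℕ} (b : Fin n → (Fin m → ℤ)) (i : ℕ) (hi : i ≤ n) :
    ∃ z : ℤ, gramDet (⇑(intVecToEuclidean m).toAddMonoidHom ∘ b) i hi = z := by
  unfold gramDet
  refine ⟨(Matrix.of fun j l => ∑ t, b (Fin.castLE hi j) t * b (Fin.castLE hi l) t).det, ?_⟩
  rw [show (⇑(intVecToEuclidean m).toAddMonoidHom ∘ b) ∘ Fin.castLE hi =
      fun j => intVecToEuclidean m (b (Fin.castLE hi j)) from rfl, gram_intVecToEuclidean,
    Int.cast_det]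

/-- For linearly independent integer vectors, `dᵢ ≥ 1`.
[cite: LenstraLenstraLovasz1982, §1 (the dᵢ are positive integers)] [cite: Bremner2011, Lemma 4.16 (proof)] -/
theorem one_le_gramDet {n : ℕ} (b : Fin n → (Fin m → ℤ))
    (hli : LinearIndependent ℝ (⇑(intVecToEuclidean m).toAddMonoidHom ∘ b)) (i : ℕ) (hi : i ≤ n) :
    1 ≤ gramDet (⇑(intVecToEuclidean m).toAddMonoidHom ∘ b) i hi := by
  obtain ⟨z, hz⟩ := exists_gramDet_eq_intCast b i hi
  have hpos := gramDet_pos hli i hi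
  rw [hz] at hpos ⊢
  exact_mod_cast hpos

/-- For linearly independent integer vectors, `D ≥ 1`. [cite: LenstraLenstraLovasz1982, Prop. 1.26 (proof)] [cite: Bremner2011, Lemma 4.18 (proof)] -/
theorem one_le_lllPotential {n : ℕ} (b : Fin n → (Fin m → ℤ))
    (hli : LinearIndependent ℝ (⇑(intVecToEuclidean m).toAddMonoidHom ∘ b)) :
    1 ≤ lllPotential (⇑(intVecToEuclidean m).toAddMonoidHom ∘ b) := by
  unfold lllPotential
  calc (1 : ℝ) = ∏ _i : Fin n, (1 : ℝ) := by simp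
    _ ≤ _ := Finset.prod_le_prod (fun _ _ => zero_le_one) fun i _ => one_le_gramDet b hli i _

end Integer

/-! ### The run: independence, the index, and the swap count -/

section Run

variable {E : Type*} [NormedAddCommGroup E] [InnerProductSpace ℝ E]
variable {V : Type*} [AddCommGroup V] (φ : V →+ E) {n : ℕ}

/-- The full Gram determinant `dₙ` is constant along the run. [folklore] -/
theorem gramDet_self_iterate (δ : ℝ) (hn : 0 < n) (b : Fin n → V) (t : ℕ) :
    gramDet (⇑φ ∘ ((lllStep φ δ)^[t] (lllStart b)).b) n le_rfl = gramDet (⇑φ ∘ b) n le_rfl := by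
  induction t with
  | zero => rfl
  | succ t ih =>
    rw [iterate_succ_apply']
    set s := (lllStep φ δ)^[t] (lllStart b)
    by_cases hk : s.k < n
    · have h1 : 1 ≤ s.k := by
        show 1 ≤ ((lllStep φ δ)^[t] (lllStart b)).k
        cases t with
        | zero => exact le_rfl
        | succ t => rw [iterate_succ_apply']; exact one_le_lllStep_k φ _ hn
      rw [(lllStep_dichotomy φ δ s ⟨h1, hk⟩).1, ih]
    · rw [lllStep_of_le φ (not_lt.1 hk), ih]

/-- Linear independence of the measured family is preserved along the run. [cite: LenstraLenstraLovasz1982, §1 (the bᵢ remain a basis)] -/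
theorem linearIndependent_iterate (δ : ℝ) (b : Fin n → V) (hli : LinearIndependent ℝ (⇑φ ∘ b))
    (t : ℕ) : LinearIndependent ℝ (⇑φ ∘ ((lllStep φ δ)^[t] (lllStart b)).b) := by
  rcases Nat.eq_zero_or_pos n with hn | hn
  · subst hn
    exact linearIndependent_empty_type
  · have h := gramDet_self_iterate φ δ hn b t
    unfold gramDet at h
    have e : ∀ g : Fin n → E, g ∘ Fin.castLE (le_refl n) = g := fun g => funext fun l => by simp
    rw [e, e] at h
    rw [← Matrix.det_gram_ne_zero_iff_linearIndependent (𝕜 := ℝ)] at hli ⊢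
    rwa [h]

end Run

/-! ### Discharge of `lll_halts_within` -/

section Halting

variable {m : ℕ}

/-- `∑_{i<n} i = n(n-1)/2` over `ℝ`. [folklore] -/
theorem cast_sum_range_id (n : ℕ) : ((∑ i ∈ Finset.range n, i : ℕ) : ℝ) = (n : ℝ) * (n - 1) / 2 := by
  have h := Finset.sum_range_id_mul_two n
  rcases Nat.eq_zero_or_pos n with hn | hn
  · subst hn; simp
  · have : ((∑ i ∈ Finset.range n, i : ℕ) : ℝ) * 2 = (n : ℝ) * (n - 1) := by
      rw [← Nat.cast_pred hn]; exact_mod_cast h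
    linarith

/-- **Discharge of `lll_halts_within`** (LLL82, proof of Prop. 1.26, first half; Bremner
Lemmas 4.14–4.18, Thm. 4.19): along the run `t + 2Nₜ + 1 ≤ kₜ + 2N₀` while not halted, where
`Nₜ = ⌊log Dₜ / log(1/δ)⌋₊` drops by at least one at each exchange (`Dₜ₊₁ ≤ δ Dₜ`, `Dₜ₊₁ ≥ 1`)
and is unchanged otherwise, and `N₀ ≤ ⌊(n(n-1)/2) log B / log(1/δ)⌋₊` by `D₀ ≤ B^{n(n-1)/2}`.
[cite: LenstraLenstraLovasz1982, Prop. 1.26 (proof)] [cite: Bremner2011, Thm. 4.19] -/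
theorem lll_halts_within_holds : lll_halts_within := by
  intro n m δ B b hδ hδ1 hli hB
  set φ := (intVecToEuclidean m).toAddMonoidHom with hφ
  rcases Nat.eq_zero_or_pos n with hn | hn
  · subst hn
    exact Nat.zero_le _
  -- notation along the run
  set L : ℝ := Real.log (1 / δ) with hL
  have hδ0 : 0 < δ := by linarith
  have hLpos : 0 < L := Real.log_pos (by rw [lt_div_iff₀ hδ0]; linarith)
  set s : ℕ → LLLState n (Fin m → ℤ) := fun t => (lllStep φ δ)^[t] (lllStart b) with hs
  set D : ℕ → ℝ := fun t => lllPotential (⇑φ ∘ (s t).b) with hD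
  set N : ℕ → ℕ := fun t => ⌊Real.log (D t) / L⌋₊ with hN
  have hli' : ∀ t, LinearIndependent ℝ (⇑φ ∘ (s t).b) := linearIndependent_iterate φ δ b hli
  have hD1 : ∀ t, 1 ≤ D t := fun t => one_le_lllPotential _ (hli' t)
  have hk1 : ∀ t, 1 ≤ (s t).k := by
    intro t
    cases t with
    | zero => exact le_rfl
    | succ t =>
      show 1 ≤ ((lllStep φ δ)^[t + 1] (lllStart b)).k
      rw [iterate_succ_apply']
      exact one_le_lllStep_k φ _ hn
  -- the invariant
  have hinv : ∀ t, n ≤ (s t).k ∨ t + 2 * N t + 1 ≤ (s t).k + 2 * N 0 := by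
    intro t
    induction t with
    | zero => exact Or.inr (by simp [hs, lllStart])
    | succ t ih =>
      have hsucc : s (t + 1) = lllStep φ δ (s t) := by
        simp only [hs]; rw [iterate_succ_apply']
      rcases ih with ih | ih
      · left
        rw [hsucc, lllStep_of_le φ ih]
        exact ih
      · by_cases hlt : (s t).k < n
        · right
          obtain ⟨-, hcase⟩ := lllStep_dichotomy φ δ (s t) ⟨hk1 t, hlt⟩
          rw [← hsucc] at hcase
          rcases hcase with ⟨hk', hD'⟩ | ⟨hk', hD'⟩
          · have hN' : N (t + 1) = N t := by simp only [hN, hD]; rw [hD']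
            rw [hN', hk']
            omega
          · -- an exchange: `N` drops
            have hD'': D (t + 1) ≤ δ * D t := hD'
            have hlog : Real.log (D (t + 1)) ≤ Real.log (D t) - L := by
              have := Real.log_le_log (by linarith [hD1 (t + 1)]) hD''
              rw [Real.log_mul hδ0.ne' (by linarith [hD1 t])] at this
              have hLδ : L = -Real.log δ := by rw [hL, one_div, Real.log_inv]
              linarith
            have hq : Real.log (D (t + 1)) / L ≤ Real.log (D t) / L - 1 := by
              rw [div_le_iff₀ hLpos, sub_mul, one_mul, div_mul_cancel₀ _ hLpos.ne']
              exact hlog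
            have h0 : 0 ≤ Real.log (D (t + 1)) / L :=
              div_nonneg (Real.log_nonneg (hD1 _)) hLpos.le
            have hNle : N (t + 1) + 1 ≤ N t := by
              have h1 : 1 ≤ Real.log (D t) / L := by linarith
              have hN1 : 1 ≤ N t := (Nat.one_le_floor_iff _).2 h1
              have : N (t + 1) ≤ N t - 1 := by
                calc N (t + 1) ≤ ⌊Real.log (D t) / L - 1⌋₊ := Nat.floor_mono hq
                  _ = N t - 1 := Nat.floor_sub_one _
              omega
            have hkt := hk1 t
            rw [hk']
            omega
        · left
          rw [hsucc, lllStep_of_le φ (not_lt.1 hlt)]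
          exact not_lt.1 hlt
  -- the bound on `N 0`
  have hN0 : N 0 ≤ ⌊((n : ℝ) * (n - 1) / 2) * Real.log B / Real.log (1 / δ)⌋₊ := by
    refine Nat.floor_mono ?_
    rw [← hL]
    refine div_le_div_of_nonneg_right ?_ hLpos.le
    have hD0 : D 0 ≤ B ^ (∑ i ∈ Finset.range n, i) := by
      simp only [hD, hs, iterate_zero, id_eq, lllStart]
      exact lllPotential_le_pow _ fun j => hB j
    have := Real.log_le_log (by linarith [hD1 0]) hD0
    rw [Real.log_pow, cast_sum_range_id] at this
    exact this
  -- conclusion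
  set T := (n - 1) + 2 * ⌊((n : ℝ) * (n - 1) / 2) * Real.log B / Real.log (1 / δ)⌋₊ with hT
  show n ≤ (s T).k
  rcases hinv T with h | h
  · exact h
  · by_contra hlt
    omega

end Halting

end Literature.Algebra.EuclideanLattices
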